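import Literature.Analysis.FluidPDE.NSViscosityRescaling
import Literature.Analysis.FluidPDE.KNSSTypeIIHolds
import Literature.Analysis.FluidPDE.NSCriticalClosureBesovBounded
import Literature.Analysis.FluidPDE.TaoLocalisationHolds
import Literature.Analysis.FluidPDE.MollifiedSliceTools
import Literature.Analysis.FluidPDE.BoundedL2ClassicalMild
import Summits.NavierStokesRegularity.NavierStokesRegularity.Theorems.PlaneEnergyCeilingPlanarEnergyLiouvilleSmallCorner
import Summits.NavierStokesRegularity.NavierStokesRegularity.Theorems.PlaneEnergyCeilingBoundedPlanarEnergyRegularityLocalClayTheory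
import HarnessLib

/-!
# `BoundedPlanarEnergyRegularity`: the small-planar-energy corner, unconditionally

Route `PlaneEnergyCeiling`, crux `BoundedPlanarEnergyRegularity` (stmt-NavierStokesRegularity-16921,
the (A)-form "bounded planar energies ⇒ Clay regularity" criterion). This file proves:

* `hasSmoothExtensionPast_of_planar_small` — **no blow-up at small planar energy**: there is an
  ABSOLUTE `ε > 0` such that a classical solution of unforced NS (`ν > 0`) on `ℝ³ × [0,T)` which is
  Leray–Hopf from its rapidly decaying datum and whose planar kinetic energies stay `≤ ε ν²` on
  `[0,T)` (every plane `R({x₂ = c})`) extends smoothly past `T`. This is the perturbative case of the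
  `p = ∞` endpoint of the anisotropic Ladyzhenskaya–Prodi–Serrin scale over all directions.
* `boundedPlanarEnergyRegularity_smallCorner` — the crux for data all of whose classical
  Leray–Hopf evolutions keep planar energies `≤ ε ν²` (registered sub-goal of the crux item), by the
  landed local Clay theory `stub_localClayTheory`.

## Proof of the continuation criterion

Normalise `ν = 1` (`w(s) = ν⁻¹ u(s/ν)` on `(0, νT)`; planar energies scale by `ν⁻²`, so `w` has
planar energies `≤ ε`). By Tao's localisation theory `w` is bounded on every `(0, T']`, `T' < νT`,
and its slices are bounded in `L²` (energy inequality), so `w` solves the Oseen integral equation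
`w(t) = e^{σΔ}w(t−σ) − B_{t−σ}(w,w)(t)` for `0 < t − σ < t < T'` (KNSS 2009, Lemma 3.1 with the
drift killed by finite energy, `mild_of_bounded_of_eLpNorm_two_le_of_lt`). The planar ceiling gives
the Morrey bound `∫_{B_r(y)} ‖w(s)‖² ≤ 2ε r`, hence `‖e^{σΔ}w(s)‖_∞ ≤ C_h √(2εV₁)/√σ`
(`norm_heatExtension_le_of_morrey`), while `‖B(w,w)‖ ≤ 2C₀ W² √σ` for `‖w‖ ≤ W` (KNSS §4). With
`E` a bound of `w` on `(0, νT/2]` and `W₀ = 1/(4C₀√(νT/2))`, any bound `W` of `w` on `(0,T')`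
improves to `max(E, W₀, ¾W)` (take `√σ = 1/(4C₀W)` when `W > W₀`, which keeps `σ < νT/2 < t`), so
`‖w‖ ≤ max(E, W₀)` on `(0, νT)` — uniformly in `T'`. Thus `u` is bounded on `[0,T) × ℝ³` and
extends past `T` (`hasSmoothExtensionPast_of_bounded_holds`, RRS 2016 Thm. 8.17).

## References

* G. Koch, N. Nadirashvili, G. Seregin, V. Šverák, Acta Math. 203 (2009), Lemma 3.1, §4
  (arXiv:0709.3599). [KochNadirashviliSereginSverak2009]
* T. Tao, *Localisation and compactness properties of the Navier–Stokes global regularity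
  problem*, Anal. PDE 6 (2013), Cor. 11.1 (arXiv:1108.1165). [Tao2011]
* J. C. Robinson, J. L. Rodrigo, W. Sadowski, *The three-dimensional Navier–Stokes equations*
  (2016), Thm. 8.17. [RobinsonRodrigoSadowski2016]
-/

noncomputable section

-- single-conjunct summit: `Summit.<Summit>.<Problem>` repeats the name by the D-0017 layout
set_option linter.dupNamespace false

namespace Summit.NavierStokesRegularity.NavierStokesRegularity.Theorems.PlaneEnergyCeilingBoundedPlanarEnergyRegularity

open MeasureTheory Set Function Filter Topology TopologicalSpace Metric WithLp
open scoped NNReal ENNReal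
open Literature.Analysis Literature.Analysis.FluidPDE
open Summit.NavierStokesRegularity.NavierStokesRegularity.Theorems.PlaneEnergyCeilingPlanarEnergyLiouville
  (norm_heatExtension_le_of_morrey)

/-! ### The forward contraction at `ν = 1` -/

/-- **One improvement step (forward problem).** Let `w` solve the Oseen integral equation between
all pairs `0 < s < t < T'`, with continuous slices obeying the Morrey bound
`∫⁻_{B_r(y)} ‖w(s)‖ₑ² ≤ I r` for `0 < s < T'`, where `K √I ≤ 1/4` for the absolute constant `K` of
`norm_le_contract_of_oseen_morrey`; let `‖w‖ ≤ E` on `(0, τ₀]` and `‖w‖ ≤ W` on `(0, T')`. Then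
`‖w‖ ≤ max (max E (1/(4 C₀ √τ₀))) (3W/4)` on `(0, T')`. [cite: KochNadirashviliSereginSverak2009, Lemma 3.1 and §4 p. 8] -/
theorem norm_le_improve_forward
    {w : ℝ → EuclideanSpace ℝ (Fin 3) → EuclideanSpace ℝ (Fin 3)} {τ₀ T' : ℝ} (hτ₀ : 0 < τ₀)
    (hrep : ∀ s t : ℝ, 0 < s → s < t → t < T' → ∀ x,
      w t x = UnboundedOperators.heatExtension (w s) (t - s) x - oseenDuhamel 1 s w w t x)
    (hmeas : ∀ s ∈ Ioo 0 T', AEStronglyMeasurable (w s) volume)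
    {I : ℝ} (hI : 0 ≤ I)
    (hMor : ∀ s ∈ Ioo 0 T', ∀ (y : EuclideanSpace ℝ (Fin 3)) (r : ℝ), 0 < r →
      ∫⁻ z in ball y r, ‖w s z‖ₑ ^ 2 ≤ ENNReal.ofReal (I * r))
    (hsmall : 4 * (2048 * (4 * Real.pi) ^ (-(3 : ℝ) / 2) *
          Real.sqrt ((volume (ball (0 : EuclideanSpace ℝ (Fin 3)) 1)).toReal)) *
        oseenSliceConst (EuclideanSpace ℝ (Fin 3)) * Real.sqrt I ≤ 1 / 4)
    {E : ℝ} (hE : ∀ s ∈ Ioc 0 τ₀, ∀ x, ‖w s x‖ ≤ E)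
    {W : ℝ} (hW : ∀ s ∈ Ioo 0 T', ∀ x, ‖w s x‖ ≤ W) :
    ∀ t ∈ Ioo 0 T', ∀ x, ‖w t x‖ ≤
      max (max E (1 / (4 * oseenSliceConst (EuclideanSpace ℝ (Fin 3)) * Real.sqrt τ₀))) (3 / 4 * W) := by
  intro t ht x
  set Ch : ℝ := 2048 * (4 * Real.pi) ^ (-(3 : ℝ) / 2) *
    Real.sqrt ((volume (ball (0 : EuclideanSpace ℝ (Fin 3)) 1)).toReal) with hCh
  set C₀ : ℝ := oseenSliceConst (EuclideanSpace ℝ (Fin 3)) with hC₀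
  have hC₀pos : 0 < C₀ := oseenSliceConst_pos
  have hChnn : 0 ≤ Ch := by positivity
  set W₀ : ℝ := 1 / (4 * C₀ * Real.sqrt τ₀) with hW₀
  have hsτ : 0 < Real.sqrt τ₀ := Real.sqrt_pos.2 hτ₀
  have hW₀pos : 0 < W₀ := by positivity
  -- early times
  rcases le_or_gt t τ₀ with htτ | htτ
  · exact (hE t ⟨ht.1, htτ⟩ x).trans ((le_max_left _ _).trans (le_max_left _ _))
  -- late times, small bound already
  rcases le_or_gt W W₀ with hWW₀ | hWW₀
  · exact (hW t ht x).trans (hWW₀.trans ((le_max_right _ _).trans (le_max_left _ _)))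
  -- late times, large bound: split at `s = t - σ`, `√σ = 1/(4 C₀ W)`
  have hWpos : 0 < W := hW₀pos.trans hWW₀
  set a : ℝ := 1 / (4 * C₀ * W) with ha
  have hapos : 0 < a := by positivity
  set σ : ℝ := a ^ 2 with hσ
  have hσpos : 0 < σ := by positivity
  have hsqσ : Real.sqrt σ = a := by rw [hσ, Real.sqrt_sq hapos.le]
  -- `σ < τ₀ < t`
  have haW₀ : a < 1 / (4 * C₀ * W₀) := by
    rw [ha]
    exact one_div_lt_one_div_of_lt (by positivity) (by nlinarith [hWW₀, hC₀pos])
  have hW₀inv : 1 / (4 * C₀ * W₀) = Real.sqrt τ₀ := by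
    rw [hW₀]; field_simp
  have hστ : σ < τ₀ := by
    have h1 : a < Real.sqrt τ₀ := hW₀inv ▸ haW₀
    calc σ = a ^ 2 := hσ
      _ < Real.sqrt τ₀ ^ 2 := pow_lt_pow_left₀ h1 hapos.le two_ne_zero
      _ = τ₀ := Real.sq_sqrt hτ₀.le
  set s : ℝ := t - σ with hs
  have hs0 : 0 < s := by rw [hs]; linarith
  have hst : s < t := by rw [hs]; linarith
  have hsT : s ∈ Ioo 0 T' := ⟨hs0, hst.trans ht.2⟩
  have hts : t - s = σ := by rw [hs]; ring
  -- the heat term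
  have hheat : ‖UnboundedOperators.heatExtension (w s) (t - s) x‖ ≤ Ch * Real.sqrt I / a := by
    rw [hts]
    have h := norm_heatExtension_le_of_morrey (hmeas s hsT) hI (hMor s hsT) hσpos x
    rw [hsqσ, Real.sqrt_mul ENNReal.toReal_nonneg] at h
    calc ‖UnboundedOperators.heatExtension (w s) σ x‖
        ≤ 2048 * (4 * Real.pi) ^ (-(3 : ℝ) / 2) *
            (Real.sqrt ((volume (ball (0 : EuclideanSpace ℝ (Fin 3)) 1)).toReal) * Real.sqrt I) / a := h
      _ = Ch * Real.sqrt I / a := by rw [hCh]; ring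
  -- the Duhamel term
  have hduh : ‖oseenDuhamel 1 s w w t x‖ ≤ C₀ * (W * W) * (2 * a) := by
    have h := norm_oseenDuhamel_le_const (E := EuclideanSpace ℝ (Fin 3)) hst.le
      (a := w) (b := w) (Ma := W) (Mb := W)
      (fun τ hτ y => hW τ ⟨hs0.trans hτ.1, hτ.2.trans ht.2⟩ y)
      (fun τ hτ y => hW τ ⟨hs0.trans hτ.1, hτ.2.trans ht.2⟩ y) x
    rwa [hts, hsqσ] at h
  have hsplit : ‖w t x‖ ≤ Ch * Real.sqrt I / a + C₀ * (W * W) * (2 * a) := by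
    rw [hrep s t hs0 hst ht.2 x]
    exact (norm_sub_le _ _).trans (add_le_add hheat hduh)
  have hkey : Ch * Real.sqrt I / a + C₀ * (W * W) * (2 * a) =
      (4 * Ch * C₀ * Real.sqrt I + 1 / 2) * W := by
    rw [ha]
    field_simp
    ring
  have hsmall' : 4 * Ch * C₀ * Real.sqrt I ≤ 1 / 4 := by
    have : 4 * Ch * C₀ * Real.sqrt I = 4 * Ch * oseenSliceConst (EuclideanSpace ℝ (Fin 3)) * Real.sqrt I := by
      rw [hC₀]
    rw [this]
    simpa only [mul_assoc] using hsmall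
  calc ‖w t x‖ ≤ Ch * Real.sqrt I / a + C₀ * (W * W) * (2 * a) := hsplit
    _ = (4 * Ch * C₀ * Real.sqrt I + 1 / 2) * W := hkey
    _ ≤ (1 / 4 + 1 / 2) * W := by gcongr
    _ = 3 / 4 * W := by ring
    _ ≤ _ := le_max_right _ _

/-- **Iterating the improvement**: under the hypotheses of `norm_le_improve_forward` (with `E ≥ 0`),
`‖w‖ ≤ max E (1/(4 C₀ √τ₀)) + (3/4)ⁿ W` on `(0, T')` for every `n`, hence
`‖w‖ ≤ max E (1/(4 C₀ √τ₀))` there — a bound that does not depend on `T'` or `W`. [folklore] -/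
theorem norm_le_of_oseen_morrey_forward
    {w : ℝ → EuclideanSpace ℝ (Fin 3) → EuclideanSpace ℝ (Fin 3)} {τ₀ T' : ℝ} (hτ₀ : 0 < τ₀)
    (hrep : ∀ s t : ℝ, 0 < s → s < t → t < T' → ∀ x,
      w t x = UnboundedOperators.heatExtension (w s) (t - s) x - oseenDuhamel 1 s w w t x)
    (hmeas : ∀ s ∈ Ioo 0 T', AEStronglyMeasurable (w s) volume)
    {I : ℝ} (hI : 0 ≤ I)
    (hMor : ∀ s ∈ Ioo 0 T', ∀ (y : EuclideanSpace ℝ (Fin 3)) (r : ℝ), 0 < r →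
      ∫⁻ z in ball y r, ‖w s z‖ₑ ^ 2 ≤ ENNReal.ofReal (I * r))
    (hsmall : 4 * (2048 * (4 * Real.pi) ^ (-(3 : ℝ) / 2) *
          Real.sqrt ((volume (ball (0 : EuclideanSpace ℝ (Fin 3)) 1)).toReal)) *
        oseenSliceConst (EuclideanSpace ℝ (Fin 3)) * Real.sqrt I ≤ 1 / 4)
    {E : ℝ} (hE0 : 0 ≤ E) (hE : ∀ s ∈ Ioc 0 τ₀, ∀ x, ‖w s x‖ ≤ E)
    {W : ℝ} (hW : ∀ s ∈ Ioo 0 T', ∀ x, ‖w s x‖ ≤ W) :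
    ∀ t ∈ Ioo 0 T', ∀ x, ‖w t x‖ ≤
      max E (1 / (4 * oseenSliceConst (EuclideanSpace ℝ (Fin 3)) * Real.sqrt τ₀)) := by
  set L : ℝ := max E (1 / (4 * oseenSliceConst (EuclideanSpace ℝ (Fin 3)) * Real.sqrt τ₀)) with hL
  have hL0 : 0 ≤ L := hE0.trans (le_max_left _ _)
  -- a nonnegative starting bound
  set W' : ℝ := max W 0 with hW'
  have hW'0 : 0 ≤ W' := le_max_right _ _
  have hWW' : ∀ s ∈ Ioo 0 T', ∀ x, ‖w s x‖ ≤ W' := fun s hs x => (hW s hs x).trans (le_max_left _ _)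
  have hiter : ∀ n : ℕ, ∀ t ∈ Ioo 0 T', ∀ x, ‖w t x‖ ≤ L + (3 / 4 : ℝ) ^ n * W' := by
    intro n
    induction n with
    | zero =>
        intro t ht x
        have := hWW' t ht x
        rw [pow_zero, one_mul]
        linarith
    | succ n ih =>
        intro t ht x
        have h := norm_le_improve_forward hτ₀ hrep hmeas hI hMor hsmall hE ih t ht x
        refine h.trans (max_le ?_ ?_)
        · have : 0 ≤ (3 / 4 : ℝ) ^ (n + 1) * W' := by positivity
          linarith
        · have h34 : 3 / 4 * (L + (3 / 4 : ℝ) ^ n * W') = 3 / 4 * L + (3 / 4 : ℝ) ^ (n + 1) * W' := by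
            ring
          rw [h34]
          nlinarith
  intro t ht x
  have hlim : Tendsto (fun n : ℕ => L + (3 / 4 : ℝ) ^ n * W') atTop (𝓝 (L + 0 * W')) :=
    ((tendsto_pow_atTop_nhds_zero_of_lt_one (by norm_num) (by norm_num)).mul_const W').const_add L
  rw [zero_mul, add_zero] at hlim
  exact ge_of_tendsto' hlim fun n => hiter n t ht x

/-! ### The continuation criterion -/

/-- **No blow-up at small planar energy (unconditional).** There is an absolute `ε > 0` such that:
if `(u,p)` is a classical solution of unforced NS (`ν > 0`) on `ℝ³ × [0,T)`, Leray–Hopf on `[0,T]`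
from its rapidly decaying datum `u 0`, and its planar kinetic energies satisfy
`∫_{R({x₂=c})} ‖u(t)‖² ≤ ε ν²` for all `t < T`, all `R`, `c`, then `u` extends smoothly past `T`.
(Normalise `ν = 1`; Tao boundedness on closed slabs + energy inequality give the Oseen
representation; the planar ceiling gives a small Morrey bound; the forward contraction bounds `u`
on `[0,T) × ℝ³`; bounded classical Leray–Hopf solutions extend.)
[cite: KochNadirashviliSereginSverak2009, Lemma 3.1 and §4; Tao2011, Cor. 11.1] -/
theorem hasSmoothExtensionPast_of_planar_small :
    ∃ ε : ℝ, 0 < ε ∧ ∀ (ν T : ℝ), 0 < ν → 0 < T →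
      ∀ (u : ℝ → EuclideanSpace ℝ (Fin 3) → EuclideanSpace ℝ (Fin 3))
        (p : ℝ → EuclideanSpace ℝ (Fin 3) → ℝ),
        Literature.Analysis.FluidPDE.IsClassicalNSSolutionOn (Set.Ico 0 T) ν 0 u p →
        Literature.Analysis.FluidPDE.IsLerayHopfOn T ν 0 (u 0) u →
        Literature.Analysis.FluidPDE.HasRapidSpatialDecay (u 0) →
        (∀ t ∈ Set.Ico 0 T, ∀ (R : EuclideanSpace ℝ (Fin 3) ≃ₗᵢ[ℝ] EuclideanSpace ℝ (Fin 3)) (c : ℝ),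
          ∫⁻ y : EuclideanSpace ℝ (Fin 2), ‖u t (R (WithLp.toLp 2 ![y 0, y 1, c]))‖ₑ ^ 2 ≤
            ENNReal.ofReal (ε * ν ^ 2)) →
        Literature.Analysis.FluidPDE.HasSmoothExtensionPast ν 0 u T := by
  -- the absolute constant (as in the Liouville corner)
  set K : ℝ := 4 * (2048 * (4 * Real.pi) ^ (-(3 : ℝ) / 2) *
      Real.sqrt ((volume (ball (0 : EuclideanSpace ℝ (Fin 3)) 1)).toReal)) *
    oseenSliceConst (EuclideanSpace ℝ (Fin 3)) with hK
  have hKpos : 0 < K := by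
    have hV : 0 < (volume (ball (0 : EuclideanSpace ℝ (Fin 3)) 1)).toReal :=
      ENNReal.toReal_pos (measure_ball_pos volume _ one_pos).ne' measure_ball_lt_top.ne
    have := oseenSliceConst_pos (E := EuclideanSpace ℝ (Fin 3))
    positivity
  refine ⟨1 / (32 * K ^ 2), by positivity, ?_⟩
  intro ν T hν hT u p hcl hLH hdec hpl
  set ε : ℝ := 1 / (32 * K ^ 2) with hεdef
  have hε : 0 < ε := by positivity
  have hν' : 0 < ν⁻¹ := inv_pos.2 hν
  have hνT : 0 < ν * T := mul_pos hν hT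
  have hu₀2 : MemLp (u 0) 2 volume := hLH.memLp 0 ⟨le_rfl, hT.le⟩
  -- ### Step 1: normalise the viscosity to `1`
  set w : ℝ → EuclideanSpace ℝ (Fin 3) → EuclideanSpace ℝ (Fin 3) := timeRescale ν⁻¹ ν⁻¹ u with hwdef
  set q : ℝ → EuclideanSpace ℝ (Fin 3) → ℝ := timeRescale ν⁻¹ (ν⁻¹ ^ 2) p with hqdef
  have hmaps : MapsTo (fun s => ν⁻¹ * s) (Ioo 0 (ν * T)) (Ioo 0 T) := fun s hs =>
    (inv_mul_mem_Ioo_iff hν).2 hs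
  have hclw : IsClassicalNSSolutionOn (Ioo 0 (ν * T)) 1 0 w q := by
    have h1 := (hcl.mono Ioo_subset_Ico_self (uniqueDiffOn_Ioo 0 T)).viscosityRescale_set hν.ne'
      hmaps (uniqueDiffOn_Ioo 0 (ν * T))
    simpa only [timeRescale_zero_force] using h1
  have hw_apply : ∀ s x, w s x = ν⁻¹ • u (ν⁻¹ * s) x := fun s x => rfl
  have hwcont : ∀ s ∈ Ioo 0 (ν * T), Continuous (w s) := fun s hs =>
    (hclw.contDiff_velocity hs).continuous
  -- ### Step 2: bounds on closed slabs (Tao) and in `L²` (energy inequality)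
  have hbddw : ∀ T' < ν * T, ∃ M₁ : ℝ, 0 ≤ M₁ ∧ ∀ s ∈ Ioc 0 T', ∀ x, ‖w s x‖ ≤ M₁ := by
    intro T' hT'
    rcases le_or_gt T' 0 with hT'0 | hT'0
    · exact ⟨0, le_rfl, fun s hs _ => absurd (hs.1.trans_le hs.2) (not_lt.2 hT'0)⟩
    · have hT₁ : ν⁻¹ * T' ∈ Ioo 0 T := (inv_mul_mem_Ioo_iff hν).2 ⟨hT'0, hT'⟩
      obtain ⟨M₁, hM₁⟩ := exists_forall_norm_le_of_tao2011 tao2011_hasBoundedSobolevNormsOn_holds hν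
        hcl hLH hdec (ν⁻¹ * T') hT₁
      refine ⟨max (ν⁻¹ * M₁) 0, le_max_right _ _, fun s hs x => ?_⟩
      rw [hw_apply, norm_smul, Real.norm_eq_abs, abs_of_pos hν']
      refine (mul_le_mul_of_nonneg_left (hM₁ _ ⟨?_, ?_⟩ x) hν'.le).trans (le_max_left _ _)
      · exact mul_nonneg hν'.le hs.1.le
      · exact mul_le_mul_of_nonneg_left hs.2 hν'.le
  have hmem_u : ∀ s ∈ Ioo 0 (ν * T), ν⁻¹ * s ∈ Icc 0 T := fun s hs =>
    ⟨(hmaps hs).1.le, (hmaps hs).2.le⟩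
  set K₀ : ℝ≥0∞ := ENNReal.ofReal ν⁻¹ * eLpNorm (u 0) 2 volume with hK₀
  have hK₀top : K₀ ≠ ⊤ := ENNReal.mul_ne_top ENNReal.ofReal_ne_top hu₀2.eLpNorm_ne_top
  have hK₀b : ∀ s ∈ Ioo 0 (ν * T), eLpNorm (w s) 2 volume ≤ K₀ := by
    intro s hs
    have h1 : w s = ν⁻¹ • u (ν⁻¹ * s) := rfl
    rw [h1, eLpNorm_const_smul, Real.enorm_eq_ofReal hν'.le, hK₀]
    gcongr
    exact hLH.eLpNorm_le_eLpNorm_datum hν.le hu₀2 (hmem_u s hs)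
  -- ### Step 3: the planar ceiling of `w` and its Morrey bound `I = 2ε`
  have hplanar_w : ∀ s ∈ Ioo 0 (ν * T),
      ∀ (R : EuclideanSpace ℝ (Fin 3) ≃ₗᵢ[ℝ] EuclideanSpace ℝ (Fin 3)) (h : ℝ),
        ∫⁻ y : EuclideanSpace ℝ (Fin 2), ‖w s (R (toLp 2 ![y 0, y 1, h]))‖ₑ ^ 2 ≤ ENNReal.ofReal ε := by
    intro s hs R h
    have ht : ν⁻¹ * s ∈ Ico 0 T := ⟨mul_nonneg hν'.le hs.1.le, (hmaps hs).2⟩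
    have h1 : ∀ y : EuclideanSpace ℝ (Fin 2), ‖w s (R (toLp 2 ![y 0, y 1, h]))‖ₑ ^ 2 =
        ENNReal.ofReal (ν⁻¹ ^ 2) * ‖u (ν⁻¹ * s) (R (toLp 2 ![y 0, y 1, h]))‖ₑ ^ 2 := by
      intro y
      rw [hw_apply, enorm_smul, mul_pow, Real.enorm_eq_ofReal hν'.le, ENNReal.ofReal_pow hν'.le]
    simp_rw [h1]
    rw [lintegral_const_mul' _ _ ENNReal.ofReal_ne_top]
    calc ENNReal.ofReal (ν⁻¹ ^ 2) * ∫⁻ y : EuclideanSpace ℝ (Fin 2),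
          ‖u (ν⁻¹ * s) (R (toLp 2 ![y 0, y 1, h]))‖ₑ ^ 2
        ≤ ENNReal.ofReal (ν⁻¹ ^ 2) * ENNReal.ofReal (ε * ν ^ 2) := by gcongr; exact hpl _ ht R h
      _ = ENNReal.ofReal ε := by
          rw [← ENNReal.ofReal_mul (by positivity)]
          congr 1
          field_simp
  have hMor : ∀ s ∈ Ioo 0 (ν * T), ∀ (y : EuclideanSpace ℝ (Fin 3)) (r : ℝ), 0 < r →
      ∫⁻ z in ball y r, ‖w s z‖ₑ ^ 2 ≤ ENNReal.ofReal (2 * ε * r) := by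
    intro s hs y r hr
    have h := PlanarEnergyAPriori.planeEnergyCeiling_scaledEnergyOfPlanar (w s) (hwcont s hs) ε hε.le
      (hplanar_w s hs) y r hr
    rwa [mul_right_comm] at h
  have hI : 0 ≤ 2 * ε := by positivity
  have hsmall : K * Real.sqrt (2 * ε) ≤ 1 / 4 := by
    have h2M : 2 * ε = 1 / (16 * K ^ 2) := by rw [hεdef]; ring
    have hsq : Real.sqrt (2 * ε) = 1 / (4 * K) := by
      rw [h2M, show 1 / (16 * K ^ 2) = (1 / (4 * K)) ^ 2 by field_simp; ring,
        Real.sqrt_sq (by positivity)]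
    rw [hsq]
    exact le_of_eq (by field_simp)
  -- ### Step 4: the uniform bound on `(0, νT)`
  set τ₀ : ℝ := ν * T / 2 with hτ₀
  have hτ₀pos : 0 < τ₀ := by positivity
  have hτ₀lt : τ₀ < ν * T := by rw [hτ₀]; linarith
  obtain ⟨E, hE0, hE⟩ := hbddw τ₀ hτ₀lt
  set L : ℝ := max E (1 / (4 * oseenSliceConst (EuclideanSpace ℝ (Fin 3)) * Real.sqrt τ₀)) with hL
  have hLbound : ∀ t ∈ Ioo 0 (ν * T), ∀ x, ‖w t x‖ ≤ L := by
    intro t ht x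
    -- work below `T' = (t + νT)/2 < T'' = (T' + νT)/2 < νT`
    set T' : ℝ := (t + ν * T) / 2 with hT'
    have htT' : t < T' := by rw [hT']; linarith [ht.2]
    have hT'lt : T' < ν * T := by rw [hT']; linarith [ht.2]
    set T'' : ℝ := (T' + ν * T) / 2 with hT''
    have hT'T'' : T' < T'' := by rw [hT'']; linarith
    have hT''lt : T'' < ν * T := by rw [hT'']; linarith
    have hT''pos : 0 < T'' := by linarith [ht.1]
    obtain ⟨W, -, hW⟩ := hbddw T'' hT''lt
    -- the Oseen representation below `T''`
    have hrep : ∀ s t₁ : ℝ, 0 < s → s < t₁ → t₁ < T' → ∀ x,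
        w t₁ x = UnboundedOperators.heatExtension (w s) (t₁ - s) x - oseenDuhamel 1 s w w t₁ x :=
      fun s t₁ hs hst₁ ht₁ x =>
        mild_of_bounded_of_eLpNorm_two_le_of_lt hclw hT''pos hT''lt hW hK₀top
          (fun τ hτ => hK₀b τ ⟨hτ.1, hτ.2.trans_lt hT''lt⟩) hs hst₁ (ht₁.trans hT'T'') x
    have hsub : ∀ s ∈ Ioo 0 T', s ∈ Ioo 0 (ν * T) := fun s hs => ⟨hs.1, hs.2.trans hT'lt⟩
    have hres := norm_le_of_oseen_morrey_forward (T' := T') hτ₀pos hrep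
      (fun s hs => (hwcont s (hsub s hs)).aestronglyMeasurable) hI
      (fun s hs => hMor s (hsub s hs)) (by simpa only [hK] using hsmall) hE0 hE
      (fun s hs x => hW s ⟨hs.1, (hs.2.trans hT'T'').le⟩ x)
    exact hres t ⟨ht.1, htT'⟩ x
  -- ### Step 5: back to `u`, bounded on `[0,T) × ℝ³`, hence extendable
  obtain ⟨C₀, hC₀⟩ := hdec 0 0
  refine hasSmoothExtensionPast_of_bounded_holds hν hT hcl hLH ⟨max (ν * L) C₀, fun t ht x => ?_⟩
  rcases ht.1.eq_or_lt with h0 | h0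
  · rw [← h0]
    have h1 := hC₀ x
    rw [pow_zero, one_mul, norm_iteratedFDeriv_zero] at h1
    exact h1.trans (le_max_right _ _)
  · have hs : ν * t ∈ Ioo 0 (ν * T) := ⟨mul_pos hν h0, mul_lt_mul_of_pos_left ht.2 hν⟩
    have h1 := hLbound (ν * t) hs x
    rw [hw_apply, ← mul_assoc, inv_mul_cancel₀ hν.ne', one_mul, norm_smul, Real.norm_eq_abs,
      abs_of_pos hν'] at h1
    have h2 : ‖u t x‖ ≤ ν * L := by
      rw [inv_mul_le_iff₀ hν] at h1
      exact h1
    exact h2.trans (le_max_left _ _)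

/-! ### The corner of the crux -/

/-- **`BoundedPlanarEnergyRegularity` at small planar energy (unconditional; registered sub-goal
of stmt-NavierStokesRegularity-16921).** There is an absolute `ε > 0` such that for every `ν > 0`
and every smooth divergence-free rapidly decaying datum `u₀`: if every classical solution of
unforced NS on `ℝ³ × [0,T)` that is Leray–Hopf from `u 0 = u₀` keeps its planar kinetic energies
`≤ ε ν²` (all `T`, planes `R({x₂=c})`), then Clay (A) holds for `u₀` — a smooth global solution with
bounded energy exists (`hasSmoothExtensionPast_of_planar_small` + the local Clay theory
`stub_localClayTheory`). [cite: KochNadirashviliSereginSverak2009, Lemma 3.1 and §4; Tao2011, Cor. 11.1] -/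
theorem boundedPlanarEnergyRegularity_smallCorner :
    ∃ ε : ℝ, 0 < ε ∧ ∀ (ν : ℝ), 0 < ν →
      ∀ (u₀ : EuclideanSpace ℝ (Fin 3) → EuclideanSpace ℝ (Fin 3)),
        ContDiff ℝ (⊤ : ℕ∞) u₀ → Literature.Analysis.FluidPDE.NSWave0.IsDivFree u₀ →
        Literature.Analysis.FluidPDE.HasRapidSpatialDecay u₀ →
        (∀ (T : ℝ), 0 < T →
          ∀ (u : ℝ → EuclideanSpace ℝ (Fin 3) → EuclideanSpace ℝ (Fin 3))
            (p : ℝ → EuclideanSpace ℝ (Fin 3) → ℝ),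
            Literature.Analysis.FluidPDE.IsClassicalNSSolutionOn (Set.Ico 0 T) ν 0 u p →
            Literature.Analysis.FluidPDE.IsLerayHopfOn T ν 0 (u 0) u → u 0 = u₀ →
            ∀ t ∈ Set.Ico 0 T, ∀ (R : EuclideanSpace ℝ (Fin 3) ≃ₗᵢ[ℝ] EuclideanSpace ℝ (Fin 3)) (c : ℝ),
              ∫⁻ y : EuclideanSpace ℝ (Fin 2), ‖u t (R (WithLp.toLp 2 ![y 0, y 1, c]))‖ₑ ^ 2 ≤
                ENNReal.ofReal (ε * ν ^ 2)) →
        ∃ (u : ℝ → EuclideanSpace ℝ (Fin 3) → EuclideanSpace ℝ (Fin 3))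
          (p : ℝ → EuclideanSpace ℝ (Fin 3) → ℝ),
          Literature.Analysis.FluidPDE.IsSmoothOnHalfSpace u ∧
          Literature.Analysis.FluidPDE.IsSmoothOnHalfSpace p ∧
          Literature.Analysis.FluidPDE.IsNavierStokesSolution ν 0 u₀ u p ∧
          Literature.Analysis.FluidPDE.HasBoundedEnergy u := by
  obtain ⟨ε, hε, h⟩ := hasSmoothExtensionPast_of_planar_small
  refine ⟨ε, hε, fun ν hν u₀ hsm hdiv hdec hpl => ?_⟩
  refine stub_localClayTheory ν hν u₀ hsm hdiv hdec fun T hT u p hcl hLH h0 => ?_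
  have hdec' : HasRapidSpatialDecay (u 0) := by rw [h0]; exact hdec
  exact h ν T hν hT u p hcl hLH hdec' (hpl T hT u p hcl hLH h0)

end Summit.NavierStokesRegularity.NavierStokesRegularity.Theorems.PlaneEnergyCeilingBoundedPlanarEnergyRegularity

end
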